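import Literature.Computability.QuantumComplexity.LetterWord
import HarnessLib

/-!
# The word circuit: the letters of a braid word read off a one-hot table

Topic `Literature/Computability/QuantumComplexity`; a step in the discharge of
`ajl_jonesApproxProblem_mem_PromiseBQP` (AJL §3.2–3.3: the unitary `Q(b) = ρ(σ_{i_r}^{±}) ⋯ ρ(σ_{i_1}^{±})`
applied controlled by the Hadamard-test qubit). The circuit does not depend on the word: for each of the
`r` letter *slots* and each possible letter `(i, ±)` it contains the letter circuit of `LetterWord.lean`
with table bit `tw s (i, ±)`; on inputs whose table wires carry the one-hot encoding of a word `b`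
(`TableSet`), slot `s` acts as the single letter `b[s]` controlled by `q` (`slot_implOn`), and the whole
circuit implements `condOn {q} (placeGate E (ajlPosCoreMatrix b))` up to `r · 2(n−1) · letterErr k`
(`wordCircuit_implOn`). Supporting algebra: conditioned unitaries are unitary and preserve supports
(`condOn_mem_unitaryGroup`, `preservesSupp_condOn`), and the one-hot reduction of a product of
conditioned gates (`condOn_mulVec_of_tableBit_false`, `condOn_mulVec_of_tableBit_true`).

## References

* D. Aharonov, V. Jones, Z. Landau, Algorithmica 55 (2009), §3.2 (the representation applied letter
  by letter), Claim 4.1 [AharonovJonesLandau2009].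
-/

noncomputable section

namespace Literature.Computability.QuantumComplexity

open _root_.Matrix Finset Cryptography RevSim
open scoped Matrix.Norms.L2Operator

variable {N : ℕ}

/-! ### Conditioned unitaries -/

/-- **A conditioned unitary commuting with the projection is unitary.** [folklore] -/
theorem condOn_mem_unitaryGroup (S : Set (QReg N)) {U : Matrix (QReg N) (QReg N) ℂ} (hU : U ∈ Matrix.unitaryGroup (QReg N) ℂ)
    (hc : U * projOn S = projOn S * U) : condOn S U ∈ Matrix.unitaryGroup (QReg N) ℂ := by
  have hP : projOn S * projOn S = projOn S := projOn_mul_projOn S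
  have hPs : (projOn S)ᴴ = projOn S := projOn_conjTranspose S
  have hUU : U * Uᴴ = 1 := Matrix.mem_unitaryGroup_iff.1 hU
  have hcH : Uᴴ * projOn S = projOn S * Uᴴ := by
    have := congrArg Matrix.conjTranspose hc
    rw [Matrix.conjTranspose_mul, Matrix.conjTranspose_mul, hPs] at this
    exact this.symm
  rw [Matrix.mem_unitaryGroup_iff, Matrix.star_eq_conjTranspose]
  -- `condOn S U = Π U + (1 − Π)` with `Π U = U Π`
  have e1 : condOn S U = projOn S * U + (1 - projOn S) := by rw [condOn, Matrix.mul_sub, Matrix.mul_one]; abel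
  have e2 : (condOn S U)ᴴ = Uᴴ * projOn S + (1 - projOn S) := by
    rw [e1, Matrix.conjTranspose_add, Matrix.conjTranspose_mul, hPs, Matrix.conjTranspose_sub, Matrix.conjTranspose_one, hPs]
  rw [e2, e1, Matrix.add_mul, Matrix.mul_add, Matrix.mul_add]
  have t1 : projOn S * U * (Uᴴ * projOn S) = projOn S := by
    rw [Matrix.mul_assoc, ← Matrix.mul_assoc U, hUU, Matrix.one_mul, hP]
  have t2 : projOn S * U * (1 - projOn S) = 0 := by
    rw [Matrix.mul_assoc, Matrix.mul_sub, Matrix.mul_one, hc, Matrix.mul_sub, ← Matrix.mul_assoc, hP, sub_self]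
  have t3 : (1 - projOn S) * (Uᴴ * projOn S) = 0 := by
    rw [Matrix.sub_mul, Matrix.one_mul, hcH, ← Matrix.mul_assoc, hP, sub_self]
  have t4 : (1 - projOn S) * (1 - projOn S) = 1 - projOn S := by
    rw [Matrix.sub_mul, Matrix.one_mul, Matrix.mul_sub, Matrix.mul_one, hP, sub_self, sub_zero]
  rw [t1, t2, t3, t4, add_zero, zero_add, add_sub_cancel]

/-- A conditioned matrix preserves every support its matrix preserves. [folklore] -/
theorem preservesSupp_condOn {P : Set (QReg N)} (S : Set (QReg N)) {U : Matrix (QReg N) (QReg N) ℂ} (h : PreservesSupp P U) :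
    PreservesSupp P (condOn S U) := by
  classical
  intro ψ hψ x hx
  have e : (condOn S U *ᵥ ψ) x = if x ∈ S then (U *ᵥ ψ) x else ψ x := by
    simp only [Matrix.mulVec, dotProduct, condOn_apply]
    split_ifs with hxS
    · rfl
    · rw [Finset.sum_eq_single x (fun z _ hz => by rw [Matrix.one_apply_ne (Ne.symm hz), zero_mul]) (fun h => absurd (Finset.mem_univ x) h),
        Matrix.one_apply_eq, one_mul]
  rw [e]; split_ifs
  · exact h ψ hψ x hx
  · exact hψ x hx

/-- `condOn` of a contraction-by-unitarity. [folklore] -/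
theorem isContraction_condOn (S : Set (QReg N)) {U : Matrix (QReg N) (QReg N) ℂ} (hU : U ∈ Matrix.unitaryGroup (QReg N) ℂ)
    (hc : U * projOn S = projOn S * U) : IsContraction (condOn S U) :=
  isContraction_of_mem_unitaryGroup (condOn_mem_unitaryGroup S hU hc)

/-! ### One-hot reduction -/

/-- The entries of `condOn (Sqw q w) A` applied to a vector. [folklore] -/
theorem condOn_Sqw_mulVec_apply (q w : Fin N) (A : Matrix (QReg N) (QReg N) ℂ) (ψ : QReg N → ℂ) (x : QReg N) :
    (condOn (Sqw q w) A *ᵥ ψ) x = if x q = true ∧ x w = true then (A *ᵥ ψ) x else ψ x := by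
  classical
  simp only [Matrix.mulVec, dotProduct, condOn_apply, mem_Sqw]
  split_ifs
  · rfl
  · rw [Finset.sum_eq_single x (fun z _ hz => by rw [Matrix.one_apply_ne (Ne.symm hz), zero_mul]) (fun h => absurd (Finset.mem_univ x) h),
      Matrix.one_apply_eq, one_mul]

/-- **A conditioned gate whose table bit is off acts as the identity** on states whose labels have
that bit off (the gate not touching the bit). [folklore] -/
theorem condOn_mulVec_of_tableBit_false {q w : Fin N} {A : Matrix (QReg N) (QReg N) ℂ} (hA : ∀ x z, x w ≠ z w → A x z = 0)
    {ψ : QReg N → ℂ} (hψ : SuppIn {z | z w = false} ψ) : condOn (Sqw q w) A *ᵥ ψ = ψ := by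
  ext x
  rw [condOn_Sqw_mulVec_apply]
  split_ifs with h
  · have hx : ψ x = 0 := hψ x (by simp [h.2])
    rw [hx, Matrix.mulVec, dotProduct]
    refine Finset.sum_eq_zero fun z _ => ?_
    by_cases hz : z w = false
    · rw [hA x z (by rw [h.2, hz]; decide), zero_mul]
    · rw [hψ z hz, mul_zero]
  · rfl

/-- **A conditioned gate whose table bit is on acts as the gate conditioned on `q` alone** on states
whose labels have that bit on. [folklore] -/
theorem condOn_mulVec_of_tableBit_true {q w : Fin N} {A : Matrix (QReg N) (QReg N) ℂ} (hA : ∀ x z, x w ≠ z w → A x z = 0)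
    {ψ : QReg N → ℂ} (hψ : SuppIn {z | z w = true} ψ) : condOn (Sqw q w) A *ᵥ ψ = condOn {z | z q = true} A *ᵥ ψ := by
  classical
  ext x
  rw [condOn_Sqw_mulVec_apply]
  have e : (condOn {z : QReg N | z q = true} A *ᵥ ψ) x = if x q = true then (A *ᵥ ψ) x else ψ x := by
    simp only [Matrix.mulVec, dotProduct, condOn_apply, Set.mem_setOf_eq]
    split_ifs
    · rfl
    · rw [Finset.sum_eq_single x (fun z _ hz => by rw [Matrix.one_apply_ne (Ne.symm hz), zero_mul]) (fun h => absurd (Finset.mem_univ x) h),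
        Matrix.one_apply_eq, one_mul]
  rw [e]
  by_cases hq : x q = true
  · by_cases hw : x w = true
    · rw [if_pos ⟨hq, hw⟩, if_pos hq]
    · rw [if_neg (fun h => hw h.2), if_pos hq]
      have hx : ψ x = 0 := hψ x hw
      rw [hx, Matrix.mulVec, dotProduct]
      symm
      refine Finset.sum_eq_zero fun z _ => ?_
      by_cases hz : z w = true
      · rw [hA x z (by rw [hz]; exact hw), zero_mul]
      · rw [hψ z hz, mul_zero]
  · rw [if_neg (fun h => hq h.1), if_neg hq]

/-- A placed gate does not change wires off its range. [folklore] -/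
theorem placeGate_apply_eq_zero_of_ne {k : ℕ} (e : Fin k ↪ Fin N) (A : Matrix (QReg k) (QReg k) ℂ) {w : Fin N} (hw : w ∉ Set.range e)
    (x z : QReg N) (h : x w ≠ z w) : placeGate e A x z = 0 := by
  rw [placeGate_apply, if_neg]
  exact fun hh => h (hh w hw)

/-! ### Chains of circuits -/

/-- The concatenation of a list of circuits, the head applied **last** (so that the matrix is the
product in list order). [folklore] -/
def chainCircuit : List (QCircuit cliffordT N) → QCircuit cliffordT N
  | [] => ⟨[]⟩
  | C :: Cs => (chainCircuit Cs).append C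

/-- The matrix of a chain is the product of the matrices (list order). [folklore] -/
theorem toMatrix_chainCircuit (A : Language Bool) : ∀ L : List (QCircuit cliffordT N),
    (chainCircuit L).toMatrix A = (L.map (QCircuit.toMatrix A)).prod
  | [] => by simp [chainCircuit]
  | C :: Cs => by rw [chainCircuit, QCircuit.toMatrix_append, toMatrix_chainCircuit A Cs, List.map_cons, List.prod_cons]

/-- The gates of a chain are gates of its members. [folklore] -/
theorem mem_of_mem_chainCircuit_gates : ∀ (L : List (QCircuit cliffordT N)) {g : QGate cliffordT N},
    g ∈ (chainCircuit L).gates → ∃ C ∈ L, g ∈ C.gates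
  | [], g, hg => by simp [chainCircuit] at hg
  | C :: Cs, g, hg => by
    simp only [chainCircuit, QCircuit.append, List.mem_append] at hg
    rcases hg with hg | hg
    · obtain ⟨C', hC', hg'⟩ := mem_of_mem_chainCircuit_gates Cs hg
      exact ⟨C', List.mem_cons_of_mem _ hC', hg'⟩
    · exact ⟨C, List.mem_cons_self .., hg⟩

/-- Placing a product is the product of the placements (list form). [folklore] -/
theorem placeGate_listProd {k : ℕ} (e : Fin k ↪ Fin N) : ∀ L : List (Matrix (QReg k) (QReg k) ℂ),
    placeGate e L.prod = (L.map (placeGate e)).prod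
  | [] => by simp
  | A :: L => by rw [List.prod_cons, placeGate_mul_holds, placeGate_listProd e L, List.map_cons, List.prod_cons]

/-! ### The geometry of a word circuit -/

/-- All possible letters `(i, ±)`. [folklore] -/
def allLetters (n : ℕ) : List (Fin (n - 1) × Bool) := (List.finRange (n - 1)).flatMap fun i => [(i, false), (i, true)]

/-- Every letter is listed. [folklore] -/
theorem mem_allLetters {n : ℕ} (p : Fin (n - 1) × Bool) : p ∈ allLetters n := by
  obtain ⟨i, b⟩ := p
  simp only [allLetters, List.mem_flatMap, List.mem_finRange, true_and, List.mem_cons, List.not_mem_nil, or_false]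
  exact ⟨i, by cases b <;> simp⟩

/-- The letters are listed once. [folklore] -/
theorem allLetters_nodup (n : ℕ) : (allLetters n).Nodup := by
  refine List.nodup_flatMap.2 ⟨fun i _ => by simp, ?_⟩
  refine (List.nodup_finRange _).pairwise_of_forall_ne fun i _ j _ hij => ?_
  simp only [Function.onFun, List.disjoint_cons_left, List.mem_cons, List.not_mem_nil, or_false, Prod.mk.injEq]
  refine ⟨by rintro (⟨h, -⟩ | ⟨h, -⟩) <;> exact hij h, ?_, fun _ h => by simp at h⟩
  rintro (⟨h, -⟩ | ⟨h, -⟩) <;> exact hij h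

variable {n r : ℕ}

/-- **The geometry of a word circuit** (one Hadamard-test copy): a gadget kit, the path register `E`,
the Hadamard-test qubit `q`, and the table wires `tw s (i, ±)` of the `r` slots. [folklore] -/
structure WordGeom (N n r : ℕ) where
  /-- the gadget kit -/
  kit : GadgetKit N
  /-- the path (vertex-sequence) register -/
  E : Fin (2 * (n + 1)) ↪ Fin N
  /-- the Hadamard-test qubit -/
  q : Fin N
  /-- the table wires -/
  tw : Fin r → Fin (n - 1) × Bool → Fin N

namespace WordGeom

variable (G : WordGeom N n r)

/-- The local register of generator `i` inside the big register. [cite: AharonovJonesLandau2009, §3.1 eq. (3.1)] -/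
def eOf (i : Fin (n - 1)) : Fin 6 ↪ Fin N := (tripleEmb i).trans G.E

/-- The labels with the Hadamard-test qubit set. [folklore] -/
def Q : Set (QReg N) := {z | z G.q = true}

/-- The labels whose table wires spell the one-hot encoding of the optional letters `β` (a slot with
no letter is the identity). [folklore] -/
def TableSet (β : Fin r → Option (Fin (n - 1) × Bool)) : Set (QReg N) := {z | ∀ s p, z (G.tw s p) = decide (β s = some p)}

/-- The braid word spelled by the optional letters (empty slots dropped). [folklore] -/
def wordOf (β : Fin r → Option (Fin (n - 1) × Bool)) : BraidWord n := (List.ofFn β).reduceOption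

/-- **Well-formedness of a word geometry.** [folklore] -/
structure OK : Prop where
  /-- the kit is well formed -/
  kit : G.kit.OK
  /-- every letter is well placed -/
  letter : ∀ s p, G.kit.LetterOK (G.eOf p.1) G.q (G.tw s p)
  /-- the path register is made of data wires off the kit -/
  E_lt : ∀ x, (G.E x : ℕ) < G.kit.rb
  E_had : ∀ x, G.E x ∉ G.kit.cr :: G.kit.as
  E_hs : ∀ x, G.E x ∉ G.kit.hs
  /-- the Hadamard-test qubit and the table wires are off the path register -/
  q_E : G.q ∉ Set.range G.E
  tw_E : ∀ s p, G.tw s p ∉ Set.range G.E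
  /-- the Hadamard-test qubit is a data wire off the kit and off the table -/
  q_lt : (G.q : ℕ) < G.kit.rb
  q_had : G.q ∉ G.kit.cr :: G.kit.as
  q_hs : G.q ∉ G.kit.hs
  q_tw : ∀ s p, G.q ≠ G.tw s p

variable {G} (hG : G.OK)
include hG

/-- Path-register wires are not region wires. [folklore] -/
theorem E_region (x : Fin (2 * (n + 1))) : G.E x ∉ G.kit.region := GadgetKit.not_mem_region_of_lt hG.kit (hG.E_lt x)

/-- The placed local core preserves the kit's clean set. [folklore] -/
theorem preservesSupp_placeGate_E_kitP (A : Matrix (QReg (2 * (n + 1))) (QReg (2 * (n + 1))) ℂ) :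
    PreservesSupp G.kit.P (placeGate G.E A) := by
  refine PreservesSupp.inter ?_ ?_ <;> refine preservesSupp_placeGate_of_offWires G.E (fun x y hxy => ?_) A <;> simp only [mem_cleanOn]
  · refine forall₂_congr fun a ha => ?_
    rw [hxy a]
    rintro ⟨j, rfl⟩
    simp only [List.cons_append, List.mem_cons, List.mem_append] at ha
    rcases ha with h | h | h
    · exact hG.E_had j (by rw [h]; exact List.mem_cons_self ..)
    · exact hG.E_had j (List.mem_cons_of_mem _ h)
    · exact E_region hG j h
  · refine forall₂_congr fun a ha => ?_
    rw [hxy a]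
    rintro ⟨j, rfl⟩
    exact hG.E_hs j ha

/-- The placed local core preserves the table set. [folklore] -/
theorem preservesSupp_placeGate_E_table (β : Fin r → Option (Fin (n - 1) × Bool)) (A : Matrix (QReg (2 * (n + 1))) (QReg (2 * (n + 1))) ℂ) :
    PreservesSupp (G.TableSet β) (placeGate G.E A) := by
  refine preservesSupp_placeGate_of_offWires G.E (fun x y hxy => ?_) A
  simp only [TableSet, Set.mem_setOf_eq]
  exact forall₂_congr fun s p => by rw [hxy _ (hG.tw_E s p)]

/-- Placed path-register matrices commute with the projection onto `Q`. [folklore] -/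
theorem placeGate_E_comm_projOn_Q (A : Matrix (QReg (2 * (n + 1))) (QReg (2 * (n + 1))) ℂ) :
    placeGate G.E A * projOn G.Q = projOn G.Q * placeGate G.E A :=
  placeGate_mul_projOn_comm G.E (fun x y hxy => by simp only [Q, Set.mem_setOf_eq]; rw [hxy _ hG.q_E]) A

/-- The ideal of a letter of a slot. [folklore] -/
def letterIdeal (s : Fin r) (p : Fin (n - 1) × Bool) : Matrix (QReg N) (QReg N) ℂ :=
  condOn (Sqw G.q (G.tw s p)) (placeGate (G.eOf p.1) (ajlLocalCore p.2))

/-- The ideal of a letter is a good ideal: contraction and support-preserving. [folklore] -/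
theorem letterIdeal_props (s : Fin r) (p : Fin (n - 1) × Bool) (β : Fin r → Option (Fin (n - 1) × Bool)) :
    IsContraction (G.letterIdeal s p) ∧ PreservesSupp G.kit.P (G.letterIdeal s p) ∧ PreservesSupp (G.TableSet β) (G.letterIdeal s p) := by
  have hL := hG.letter s p
  have hplace : placeGate (G.eOf p.1) (ajlLocalCore p.2) = placeGate G.E (placeGate (tripleEmb p.1) (ajlLocalCore p.2)) := by
    rw [placeGate_placeGate]; rfl
  refine ⟨?_, ?_, ?_⟩
  · exact isContraction_condOn _ (placeGate_mem_unitaryGroup_holds _ (ajlLocalCore_mem_unitaryGroup p.2))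
      (placeGate_comm_projOn_Sqw hL.q_e hL.w_e _)
  · rw [letterIdeal, hplace]; exact preservesSupp_condOn _ (preservesSupp_placeGate_E_kitP hG _)
  · rw [letterIdeal, hplace]; exact preservesSupp_condOn _ (preservesSupp_placeGate_E_table hG β _)

/-! ### One slot -/

/-- The circuit of slot `s`: all letter circuits, chained. [cite: AharonovJonesLandau2009, §3.2] -/
def slotCircuit (s : Fin r) : QCircuit cliffordT N :=
  chainCircuit ((allLetters n).map fun p => GadgetKit.letterCircuit hG.kit (hG.letter s p) p.2)

/-- **Slot `s` implements the product of its letter ideals.** [cite: AharonovJonesLandau2009, Claim 4.1] -/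
theorem slot_implOn_prod (s : Fin r) (β : Fin r → Option (Fin (n - 1) × Bool)) :
    ImplOn (G.kit.P ∩ G.TableSet β) ((slotCircuit hG s).toMatrix 0) (((allLetters n).map (G.letterIdeal s)).prod)
      ((allLetters n).length * GadgetKit.letterErr G.kit.k) := by
  have h := ImplOn.listProd (P := G.kit.P ∩ G.TableSet β)
    (L := (allLetters n).map fun p => (⟨(GadgetKit.letterCircuit hG.kit (hG.letter s p) p.2).toMatrix 0, G.letterIdeal s p, GadgetKit.letterErr G.kit.k⟩ : ApproxStep N))
    (by
      intro st hst
      rw [List.mem_map] at hst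
      obtain ⟨p, -, rfl⟩ := hst
      obtain ⟨c1, c2, c3⟩ := letterIdeal_props hG s p β
      exact
        { implOn := (GadgetKit.letterCircuit_implOn hG.kit (hG.letter s p) p.2).of_subset Set.inter_subset_left
          act_contr := isContraction_of_mem_unitaryGroup (QCircuit.toMatrix_mem_unitaryGroup_holds cliffordT_isUnitary_holds 0 _)
          ideal_contr := c1
          ideal_pres := c2.inter c3
          err_nonneg := by show (0 : ℝ) ≤ GadgetKit.letterErr G.kit.k; unfold GadgetKit.letterErr GadgetKit.rotErr GadgetKit.phaseErr; positivity })
  simp only [List.map_map, Function.comp_def] at h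
  rw [slotCircuit, toMatrix_chainCircuit, List.map_map, Function.comp_def]
  have hsum : ((allLetters n).map fun _ => GadgetKit.letterErr G.kit.k).sum = (allLetters n).length * GadgetKit.letterErr G.kit.k := by
    rw [List.map_const', List.sum_replicate, nsmul_eq_mul]
  rw [← hsum]
  exact h

/-- The ideal of a slot holding the optional letter `o`: the conditioned placed core, or the
identity. [folklore] -/
def optIdeal (o : Option (Fin (n - 1) × Bool)) : Matrix (QReg N) (QReg N) ℂ :=
  match o with
  | none => 1
  | some p => condOn G.Q (placeGate (G.eOf p.1) (ajlLocalCore p.2))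

/-- **One-hot reduction of a slot**: on table-consistent states the product of the letter ideals is
the slot's optional letter conditioned on `q`. [folklore] -/
theorem slot_prod_mulVec (s : Fin r) (β : Fin r → Option (Fin (n - 1) × Bool)) : ∀ (L : List (Fin (n - 1) × Bool)), L.Nodup →
    ∀ ψ, SuppIn (G.TableSet β) ψ →
      (L.map (G.letterIdeal s)).prod *ᵥ ψ = if β s ∈ L.map some then G.optIdeal (β s) *ᵥ ψ else ψ
  | [], _, ψ, _ => by simp
  | p :: L, hnd, ψ, hψ => by
    have hpL : p ∉ L := (List.nodup_cons.1 hnd).1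
    have ih := slot_prod_mulVec s β L (List.nodup_cons.1 hnd).2 ψ hψ
    rw [List.map_cons, List.prod_cons, ← Matrix.mulVec_mulVec, ih]
    have hA : ∀ x z : QReg N, x (G.tw s p) ≠ z (G.tw s p) → placeGate (G.eOf p.1) (ajlLocalCore p.2) x z = 0 :=
      fun x z h => placeGate_apply_eq_zero_of_ne _ _ (hG.letter s p).w_e x z h
    -- the intermediate vector is table-consistent
    have hpres : PreservesSupp (G.TableSet β) (G.optIdeal (β s)) := by
      cases hβ : β s with
      | none => simpa [optIdeal] using preservesSupp_one (G.TableSet β)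
      | some p' =>
        simp only [optIdeal]
        refine preservesSupp_condOn _ ?_
        rw [show placeGate (G.eOf p'.1) (ajlLocalCore p'.2) = placeGate G.E (placeGate (tripleEmb p'.1) (ajlLocalCore p'.2)) by
          rw [placeGate_placeGate]; rfl]
        exact preservesSupp_placeGate_E_table hG β _
    have hψ' : SuppIn (G.TableSet β) (if β s ∈ L.map some then G.optIdeal (β s) *ᵥ ψ else ψ) := by
      split_ifs
      · exact hpres ψ hψ
      · exact hψ
    by_cases hp : β s = some p
    · -- the hot letter
      have hm : β s ∉ L.map some := by rw [hp]; simpa using hpL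
      rw [if_neg hm] at hψ' ⊢
      rw [if_pos (by rw [hp]; simp), letterIdeal, hp, optIdeal]
      exact condOn_mulVec_of_tableBit_true hA fun z hz => hψ z fun h => hz (by simp only [Set.mem_setOf_eq]; rw [h s p]; simp [hp])
    · rw [letterIdeal, condOn_mulVec_of_tableBit_false hA fun z hz => hψ' z fun h => hz (by simp only [Set.mem_setOf_eq]; rw [h s p]; simp [hp])]
      by_cases hm : β s ∈ L.map some
      · rw [if_pos hm, if_pos (by rw [List.map_cons]; exact List.mem_cons_of_mem _ hm)]
      · rw [if_neg hm, if_neg]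
        simp only [List.map_cons, List.mem_cons, not_or]
        exact ⟨fun h => hp h, hm⟩

/-- **Slot `s` acts as its optional letter conditioned on `q`** on table-consistent kit-clean inputs.
[cite: AharonovJonesLandau2009, §3.2 and Claim 4.1] -/
theorem slot_implOn (s : Fin r) (β : Fin r → Option (Fin (n - 1) × Bool)) :
    ImplOn (G.kit.P ∩ G.TableSet β) ((slotCircuit hG s).toMatrix 0) (G.optIdeal (β s)) ((allLetters n).length * GadgetKit.letterErr G.kit.k) := by
  have h1 := slot_implOn_prod hG s β
  have h2 : ImplOn (G.kit.P ∩ G.TableSet β) (((allLetters n).map (G.letterIdeal s)).prod) (G.optIdeal (β s)) 0 := by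
    intro ψ hψ
    rw [slot_prod_mulVec hG s β (allLetters n) (allLetters_nodup n) ψ (fun z hz => hψ z fun h => hz h.2)]
    cases hβ : β s with
    | none => simp [optIdeal]
    | some p => rw [if_pos (List.mem_map.2 ⟨p, mem_allLetters p, rfl⟩), sub_self, l2Norm_zero, zero_mul]
  simpa using h1.trans h2

/-! ### The word -/

/-- **The word circuit**: all slots, chained (slot `0` applied last, as in `ajlPosCoreMatrix`).
[cite: AharonovJonesLandau2009, §3.2] -/
def wordCircuit : QCircuit cliffordT N := chainCircuit ((List.finRange r).map (slotCircuit hG))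

/-- The error of the word circuit. [folklore] -/
def wordErr (n r k : ℕ) : ℝ := r * ((allLetters n).length * GadgetKit.letterErr k)

omit hG in
/-- Products over optional letters are products over the word they spell. [folklore] -/
theorem prod_map_option_elim {M : Type*} [Monoid M] (f : Fin (n - 1) × Bool → M) :
    ∀ l : List (Option (Fin (n - 1) × Bool)), (l.map fun o => o.elim 1 f).prod = (l.reduceOption.map f).prod
  | [] => by simp
  | none :: l => by rw [List.map_cons, List.prod_cons, Option.elim, one_mul, List.reduceOption_cons_of_none, prod_map_option_elim f l]
  | some p :: l => by rw [List.map_cons, List.prod_cons, Option.elim, List.reduceOption_cons_of_some, List.map_cons, List.prod_cons, prod_map_option_elim f l]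

omit hG in
/-- The optional ideal as a conditioned placed matrix. [folklore] -/
theorem optIdeal_eq (o : Option (Fin (n - 1) × Bool)) :
    G.optIdeal o = condOn G.Q (placeGate G.E (o.elim 1 fun p => placeGate (tripleEmb p.1) (ajlLocalCore p.2))) := by
  cases o with
  | none => simp [optIdeal, Option.elim]
  | some p => simp only [optIdeal, Option.elim]; rw [placeGate_placeGate]; rfl

/-- **The word circuit implements `Q(b)` conditioned on the Hadamard-test qubit**: on kit-clean inputs
whose table wires spell the optional letters `β`, it implements `condOn Q (placeGate E (ajlPosCoreMatrix (wordOf β)))`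
up to `r · 2(n−1) · letterErr k`. [cite: AharonovJonesLandau2009, §3.2 and Claim 4.1] -/
theorem wordCircuit_implOn (β : Fin r → Option (Fin (n - 1) × Bool)) :
    ImplOn (G.kit.P ∩ G.TableSet β) ((wordCircuit hG).toMatrix 0) (condOn G.Q (placeGate G.E (ajlPosCoreMatrix (wordOf β))))
      (wordErr n r G.kit.k) := by
  have h := ImplOn.listProd (P := G.kit.P ∩ G.TableSet β)
    (L := (List.finRange r).map fun s => (⟨(slotCircuit hG s).toMatrix 0, G.optIdeal (β s), (allLetters n).length * GadgetKit.letterErr G.kit.k⟩ : ApproxStep N))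
    (by
      intro st hst
      rw [List.mem_map] at hst
      obtain ⟨s, -, rfl⟩ := hst
      exact
        { implOn := slot_implOn hG s β
          act_contr := isContraction_of_mem_unitaryGroup (QCircuit.toMatrix_mem_unitaryGroup_holds cliffordT_isUnitary_holds 0 _)
          ideal_contr := by
            show IsContraction (G.optIdeal (β s))
            rw [optIdeal_eq]
            refine isContraction_condOn _ (placeGate_mem_unitaryGroup_holds _ ?_) (placeGate_E_comm_projOn_Q hG _)
            cases β s with
            | none => exact Submonoid.one_mem _
            | some p => exact placeGate_mem_unitaryGroup_holds _ (ajlLocalCore_mem_unitaryGroup _)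
          ideal_pres := by
            show PreservesSupp (G.kit.P ∩ G.TableSet β) (G.optIdeal (β s))
            rw [optIdeal_eq]
            exact preservesSupp_condOn _ ((preservesSupp_placeGate_E_kitP hG _).inter (preservesSupp_placeGate_E_table hG β _))
          err_nonneg := by
            show (0 : ℝ) ≤ (allLetters n).length * GadgetKit.letterErr G.kit.k
            unfold GadgetKit.letterErr GadgetKit.rotErr GadgetKit.phaseErr; positivity })
  simp only [List.map_map, Function.comp_def] at h
  -- the actual side is the word circuit
  rw [wordCircuit, toMatrix_chainCircuit, List.map_map, Function.comp_def]
  -- the ideal side is the conditioned placed core matrix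
  have hideal : ((List.finRange r).map fun s => G.optIdeal (β s)).prod = condOn G.Q (placeGate G.E (ajlPosCoreMatrix (wordOf β))) := by
    have e1 : ((List.finRange r).map fun s => G.optIdeal (β s)) =
        ((List.finRange r).map fun s => placeGate G.E ((β s).elim 1 fun p => placeGate (tripleEmb p.1) (ajlLocalCore p.2))).map (condOn G.Q) := by
      rw [List.map_map]; exact List.map_congr_left fun s _ => by rw [Function.comp_apply, optIdeal_eq]
    rw [e1, condOn_listProd _ _ (fun A hA => by
      rw [List.mem_map] at hA; obtain ⟨s, -, rfl⟩ := hA; exact placeGate_E_comm_projOn_Q hG _)]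
    congr 1
    have e2 : ((List.finRange r).map fun s => placeGate G.E ((β s).elim 1 fun p => placeGate (tripleEmb p.1) (ajlLocalCore p.2))) =
        (((List.finRange r).map β).map fun o => o.elim 1 fun p => placeGate (tripleEmb p.1) (ajlLocalCore p.2)).map (placeGate G.E) := by
      rw [List.map_map, List.map_map]; rfl
    rw [e2, ← placeGate_listProd, prod_map_option_elim, ajlPosCoreMatrix, wordOf, List.ofFn_eq_map]
  rw [hideal] at h
  have hsum : ((List.finRange r).map fun _ => (allLetters n).length * GadgetKit.letterErr G.kit.k).sum = wordErr n r G.kit.k := by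
    rw [List.map_const', List.sum_replicate, nsmul_eq_mul, List.length_finRange]; rfl
  rw [← hsum]
  exact h

end WordGeom

end Literature.Computability.QuantumComplexity

end
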